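import Summits.HodgeConjecture.HodgeConjecture.Theses.LimitExtension
import Literature.AlgebraicGeometry.HodgeTheory.GlobalInvariantCycles

/-!
# Crux `LimitExtensionMid` (stmt-HodgeConjecture-2995) — birth skeleton `Lines/birth.lean` (BC3)

Route `HodgeConjecture/LimitExtension`, crux #2 `LimitExtensionMid` (LE): every rational middle
`(k,k)`-class `α` on a smooth projective `2k`-fold `X` is, modulo `N¹H^{2k}(X)`, the pull-back
`(g ≫ ι_{t₀})^* B` of a rational class `B` on the total space of a flat proper one-parameter
degeneration `f : W → T` of smooth `2k`-dimensional hypersurfaces onto (a birational image of) `X`,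
`B` being of type `(k,k)` on EVERY smooth fibre `W_t`, `t ≠ t₀`.

## The cut (ANCHOR + FIXED PART), four registered stubs

The clause "`B|_{W_t}` is of type `(k,k)` for every `t ≠ t₀`" is what forces the curve `T` to lie in
the Hodge locus of the flat section `t ↦ B|_{W_t}` of `R^{2k} f_* ℚ` over the punctured curve
`T ∖ {t₀}`.  By the theorem of the fixed part (Deligne, Hodge II 4.1.1–4.1.2; Charles–Schnell
Prop. 11.3.5 (1): a flat RATIONAL section that is a Hodge class at ONE point of a smooth connected
base is a Hodge class at EVERY point) this clause is equivalent to its instance at a single ANCHOR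
fibre `W_{t₁}`, `t₁ ≠ t₀`.  The crux therefore splits as

* `stub_anchoredExtension` — **the open heart** (HC-implied, like the crux): for `(X, α)` there are a
  hypersurface degeneration `(T, W, f, t₀, g)` onto a birational image of `X`, a rational class `B` on
  `W(ℂ)` and ONE anchor `t₁ ≠ t₀` with `B|_{W_{t₁}}` of type `(k,k)`, such that
  `α - (g ≫ ι_{t₀})^*B ∈ N¹`.  What the anchor form exposes: the anchor fibre may be CHOSEN — a
  hypersurface with a large explicitly known Hodge (indeed algebraic) lattice (Fermat hypersurfaces,
  Shioda 1979; hypersurfaces containing many linear or complete-intersection subvarieties) — so the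
  heart becomes "reach `α mod N¹` from the known Hodge lattice of a special hypersurface through a
  rational class on a connecting total space": a topological statement about the cohomology of the
  incidence variety `W ⊂ P^{2k+1} × T` relative to its two ends, plus the choice of the receptacle.
* `stub_hodgeClassOfFlat` — the vendored NAMED FACT
  `Literature.AlgebraicGeometry.HodgeTheory.charlesSchnell_hodgeClass_of_flat` (Charles–Schnell
  Prop. 11.3.5 (1) ⟸ Deligne Hodge II Thm. 4.1.1 + semisimplicity), listed as a stub because a
  skeleton may take no unproved hypothesis (tier-0 debt of the tree, shared with route AnchorTransport).
* `stub_fixedPartOnPuncturedCurve` — **infrastructure, provable now** from the named fact: in the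
  LE setting (`T` a smooth irreducible curve, `f` flat proper, fibres over `t ≠ t₀` smooth
  hypersurfaces, `B` rational on `W(ℂ)`), Hodge type `(k,k)` of `B|_{W_{t₁}}` at one `t₁ ≠ t₀`
  propagates to all `t ≠ t₀`.  Proof plan: `U := T ∖ {t₀}` is a smooth irreducible (hence `U(ℂ)`
  connected) quasi-projective curve; `f_U : W_U → U` is flat, proper, of finite presentation with smooth
  fibres over all closed points, hence smooth (the non-smooth locus is closed and contains no closed
  point) of relative dimension `2k` with smooth projective fibres — an `IsSmoothProjectiveFamily`;
  `t ↦ (B|_{W_U})|_{W_t}` is a continuous rational section (`globalSection_isSection`,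
  `IsRationalClass.pullback`); apply the fact and transport `IsOfHodgeType` along the canonical
  isomorphisms `fiberOver f_U t ≅ fiberOver f t` (`HodgeModel.ofIso`).
* `stub_hypersurfaceDegeneration` — **classical geometry, provable in principle** (generic projection
  `X → X' ⊂ P^{2k+1}`, finite birational onto a degree-`e` hypersurface, Hartshorne IV.3/Shafarevich
  II.5.4; the pencil `sG + uF` with `F` a general degree-`e` form is flat over `P¹` minus the other
  critical values — an integral total space dominating a smooth curve, Hartshorne III.9.7 — proper,
  with special fibre `X'` and smooth hypersurface fibres elsewhere, Bertini): every smooth projective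
  `2k`-fold is birational to (a component of) the special fibre of a flat proper one-parameter family
  of smooth `2k`-dimensional hypersurfaces.  It carries the classes ALREADY supported on a divisor
  (`α ∈ N¹`: witness `B = 0`) — the route header's necessity audit (cheapest falsifier (b)/(c)) in
  checked form — and it is the carrier every proof of the heart starts from.

Composition `LimitExtensionMid_of` (no `sorry` outside the stubs; hypotheses = the registered stubs
by name): case `α ∈ N¹` — the degeneration of `stub_hypersurfaceDegeneration` with `B := 0`
(`IsRationalClass.zero`; `0` is of type `(k,k)` on each smooth fibre by `IsOfHodgeType.zero` and the
PROVED route support `HodgeModels_holds`; `α - 0 ∈ N¹`); case `α ∉ N¹` — the anchored extension, the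
Hodge type on every smooth fibre supplied by `stub_fixedPartOnPuncturedCurve ∘ stub_hodgeClassOfFlat`.

Disproof used: none on file (`ledger crux ls stmt-HodgeConjecture-2995`: no `Disproof.lean`, no
landed `Negative/` lemma at registration time).  Negatives index: no refuted statement of the summit
concerns degenerations / limit extensions (checked `ledger negatives --problem HodgeConjecture`).
-/

set_option linter.dupNamespace false

noncomputable section

open CategoryTheory AlgebraicGeometry
open Literature.AlgebraicGeometry.Motives Literature.AlgebraicGeometry.HodgeTheory

namespace Summit.HodgeConjecture.HodgeConjecture.Cruxes.LimitExtensionMid.Birth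

/-! ## §1 The pieces, as named statements -/

/-- **Hypersurface degeneration of a smooth projective `2k`-fold** (generic projection + pencil):
for `X` smooth projective of dimension `2k`, `k ≥ 1`, there are a smooth irreducible complex curve
`T`, a flat proper `f : W ⟶ T`, `t₀ ∈ T(ℂ)` and `g : X ⟶ W_{t₀}` restricting to an open immersion on
a nonempty open `U ⊆ X`, such that every fibre `W_t`, `t ≠ t₀`, is a smooth hypersurface of
dimension `2k` (of some degree).  The geometric clauses of `LimitExtensionMid`, with no class.
[Hartshorne1977 III.9.7, IV.3; Fulton1998 §10.1; PeskineSzpiro1974 for the liaison variant] -/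
def HypersurfaceDegeneration : Prop :=
  ∀ ⦃k : ℕ⦄ ⦃X : SchemeOver ℂ⦄, 0 < k → IsSmoothProjective (2 * k) X →
    ∃ (T W : SchemeOver ℂ) (f : W ⟶ T) (t₀ : ComplexPoints T) (g : X ⟶ fiberOver f t₀),
      SmoothOfRelativeDimension 1 T.hom ∧ IrreducibleSpace T.left ∧ Flat f.left ∧ IsProper f.left ∧
      (∃ U : X.left.Opens, (U : Set X.left).Nonempty ∧ IsOpenImmersion (U.ι ≫ g.left)) ∧
      ∀ t : ComplexPoints T, t ≠ t₀ → ∃ d : ℕ, IsSmoothHypersurface (2 * k) d (fiberOver f t)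

/-- **Theorem of the fixed part on the punctured curve of a hypersurface degeneration**: in the
setting of `LimitExtensionMid` (`T` smooth irreducible curve, `f : W ⟶ T` flat proper, fibres over
`t ≠ t₀` smooth `2k`-dimensional hypersurfaces), a RATIONAL class `B ∈ H^{2k}(W(ℂ); ℂ)` whose
restriction to ONE fibre `W_{t₁}`, `t₁ ≠ t₀`, is of type `(k,k)` restricts to a class of type `(k,k)`
on EVERY fibre `W_t`, `t ≠ t₀`.  [DeligneHodgeII1971 Thm. 4.1.1, Cor. 4.1.2;
CharlesSchnell2014Notes Prop. 11.3.5 (1)] -/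
def FixedPartOnPuncturedCurve : Prop :=
  ∀ ⦃k : ℕ⦄ ⦃T W : SchemeOver ℂ⦄ (f : W ⟶ T) (t₀ : ComplexPoints T) (B : complexBetti W (2 * k)),
    SmoothOfRelativeDimension 1 T.hom → IrreducibleSpace T.left → Flat f.left → IsProper f.left →
    IsRationalClass B →
    (∀ t : ComplexPoints T, t ≠ t₀ → ∃ d : ℕ, IsSmoothHypersurface (2 * k) d (fiberOver f t)) →
    ∀ t₁ : ComplexPoints T, t₁ ≠ t₀ →
      IsOfHodgeType (2 * k) (fiberOver f t₁) (2 * k) k k (complexBetti.map (fiberι f t₁) (2 * k) B) →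
      ∀ t : ComplexPoints T, t ≠ t₀ →
        IsOfHodgeType (2 * k) (fiberOver f t) (2 * k) k k (complexBetti.map (fiberι f t) (2 * k) B)

/-- **Anchored limit extension (the heart)**: for `X` smooth projective of dimension `2k`, `k ≥ 1`,
and a rational `(k,k)`-class `α ∈ H^{2k}(X(ℂ); ℂ)` NOT already supported on a divisor, there are a
hypersurface degeneration `(T, W, f, t₀, g)` onto a birational image of `X` (clauses as in
`LimitExtensionMid`), a rational class `B ∈ H^{2k}(W(ℂ); ℂ)` and ONE anchor `t₁ ≠ t₀` at which
`B|_{W_{t₁}}` is of type `(k,k)`, with `α - (g ≫ ι_{t₀})^* B ∈ N¹ H^{2k}(X(ℂ); ℂ)`.  HC-implied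
(under HC the hypothesis `α ∉ N¹` is void); the one-anchor weakening of the crux.
[GriffithsHarris1985; CilibertoLopez1991; CattaniDeligneKaplan1995JAMS; Shioda1979HodgeFermat] -/
def AnchoredExtension : Prop :=
  ∀ ⦃k : ℕ⦄ ⦃X : SchemeOver ℂ⦄, 0 < k → IsSmoothProjective (2 * k) X →
    ∀ α : complexBetti X (2 * k), IsRationalClass α → IsOfHodgeType (2 * k) X (2 * k) k k α →
      α ∉ supportedClasses X (2 * k) 1 →
      ∃ (T W : SchemeOver ℂ) (f : W ⟶ T) (t₀ : ComplexPoints T) (g : X ⟶ fiberOver f t₀)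
        (B : complexBetti W (2 * k)),
        SmoothOfRelativeDimension 1 T.hom ∧ IrreducibleSpace T.left ∧ Flat f.left ∧ IsProper f.left ∧
        (∃ U : X.left.Opens, (U : Set X.left).Nonempty ∧ IsOpenImmersion (U.ι ≫ g.left)) ∧
        IsRationalClass B ∧
        (∀ t : ComplexPoints T, t ≠ t₀ → ∃ d : ℕ, IsSmoothHypersurface (2 * k) d (fiberOver f t)) ∧
        (∃ t₁ : ComplexPoints T, t₁ ≠ t₀ ∧
          IsOfHodgeType (2 * k) (fiberOver f t₁) (2 * k) k k (complexBetti.map (fiberι f t₁) (2 * k) B)) ∧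
        α - complexBetti.map (g ≫ fiberι f t₀) (2 * k) B ∈ supportedClasses X (2 * k) 1

/-! ## §2 Registered stubs (`sorry` lives ONLY in these four theorems) -/

section Stubs

/-- STUB G (registered form = `HypersurfaceDegeneration`): generic projection + pencil. -/
theorem stub_hypersurfaceDegeneration :
    ∀ ⦃k : ℕ⦄ ⦃X : SchemeOver ℂ⦄, 0 < k → IsSmoothProjective (2 * k) X →
      ∃ (T W : SchemeOver ℂ) (f : W ⟶ T) (t₀ : ComplexPoints T) (g : X ⟶ fiberOver f t₀),
        SmoothOfRelativeDimension 1 T.hom ∧ IrreducibleSpace T.left ∧ Flat f.left ∧ IsProper f.left ∧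
        (∃ U : X.left.Opens, (U : Set X.left).Nonempty ∧ IsOpenImmersion (U.ι ≫ g.left)) ∧
        ∀ t : ComplexPoints T, t ≠ t₀ → ∃ d : ℕ, IsSmoothHypersurface (2 * k) d (fiberOver f t) := by
  sorry

/-- STUB F0 (registered form = the vendored named fact `charlesSchnell_hodgeClass_of_flat`,
Charles–Schnell Prop. 11.3.5 (1) / Deligne Hodge II 4.1.1: a flat rational section which is a Hodge
class at one point of a smooth connected quasi-projective base is a Hodge class everywhere).  Tier-0
debt: a skeleton may take no unproved hypothesis. -/
theorem stub_hodgeClassOfFlat : charlesSchnell_hodgeClass_of_flat := by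
  sorry

/-- STUB F1 (registered form = `charlesSchnell_hodgeClass_of_flat → FixedPartOnPuncturedCurve`):
the infrastructure specialising the named fact to the punctured curve `T ∖ {t₀}` of a flat proper
hypersurface degeneration (flat + smooth closed fibres ⇒ smooth family; smooth irreducible punctured
curve ⇒ quasi-projective with connected complex points; fibre transport). -/
theorem stub_fixedPartOnPuncturedCurve :
    charlesSchnell_hodgeClass_of_flat →
    ∀ ⦃k : ℕ⦄ ⦃T W : SchemeOver ℂ⦄ (f : W ⟶ T) (t₀ : ComplexPoints T) (B : complexBetti W (2 * k)),
      SmoothOfRelativeDimension 1 T.hom → IrreducibleSpace T.left → Flat f.left → IsProper f.left →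
      IsRationalClass B →
      (∀ t : ComplexPoints T, t ≠ t₀ → ∃ d : ℕ, IsSmoothHypersurface (2 * k) d (fiberOver f t)) →
      ∀ t₁ : ComplexPoints T, t₁ ≠ t₀ →
        IsOfHodgeType (2 * k) (fiberOver f t₁) (2 * k) k k (complexBetti.map (fiberι f t₁) (2 * k) B) →
        ∀ t : ComplexPoints T, t ≠ t₀ →
          IsOfHodgeType (2 * k) (fiberOver f t) (2 * k) k k
            (complexBetti.map (fiberι f t) (2 * k) B) := by
  sorry

/-- STUB A (registered form = `AnchoredExtension`; HARDEST, open): the one-anchor limit extension of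
a middle Hodge class not supported on a divisor. -/
theorem stub_anchoredExtension :
    ∀ ⦃k : ℕ⦄ ⦃X : SchemeOver ℂ⦄, 0 < k → IsSmoothProjective (2 * k) X →
      ∀ α : complexBetti X (2 * k), IsRationalClass α → IsOfHodgeType (2 * k) X (2 * k) k k α →
        α ∉ supportedClasses X (2 * k) 1 →
        ∃ (T W : SchemeOver ℂ) (f : W ⟶ T) (t₀ : ComplexPoints T) (g : X ⟶ fiberOver f t₀)
          (B : complexBetti W (2 * k)),
          SmoothOfRelativeDimension 1 T.hom ∧ IrreducibleSpace T.left ∧ Flat f.left ∧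
          IsProper f.left ∧
          (∃ U : X.left.Opens, (U : Set X.left).Nonempty ∧ IsOpenImmersion (U.ι ≫ g.left)) ∧
          IsRationalClass B ∧
          (∀ t : ComplexPoints T, t ≠ t₀ → ∃ d : ℕ, IsSmoothHypersurface (2 * k) d (fiberOver f t)) ∧
          (∃ t₁ : ComplexPoints T, t₁ ≠ t₀ ∧
            IsOfHodgeType (2 * k) (fiberOver f t₁) (2 * k) k k
              (complexBetti.map (fiberι f t₁) (2 * k) B)) ∧
          α - complexBetti.map (g ≫ fiberι f t₀) (2 * k) B ∈ supportedClasses X (2 * k) 1 := by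
  sorry

end Stubs

/-! ### Name-keyed aliases (the skeleton audit matches a hypothesis head to a declared stub by its
last name component) -/
namespace Registered

/-- Alias of `HypersurfaceDegeneration` keyed by the registered stub name. -/
abbrev stub_hypersurfaceDegeneration : Prop := HypersurfaceDegeneration
/-- Alias of the vendored fact keyed by the registered stub name. -/
abbrev stub_hodgeClassOfFlat : Prop := charlesSchnell_hodgeClass_of_flat
/-- Alias of `charlesSchnell_hodgeClass_of_flat → FixedPartOnPuncturedCurve` keyed by the stub name. -/
abbrev stub_fixedPartOnPuncturedCurve : Prop :=
  charlesSchnell_hodgeClass_of_flat → FixedPartOnPuncturedCurve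
/-- Alias of `AnchoredExtension` keyed by the registered stub name. -/
abbrev stub_anchoredExtension : Prop := AnchoredExtension

end Registered

/-! Consistency: each alias IS its registered stub (definitional unfolding only; `example`s, so no
second theorem concludes anything by name). -/
example : Registered.stub_hypersurfaceDegeneration := stub_hypersurfaceDegeneration
example : Registered.stub_hodgeClassOfFlat := stub_hodgeClassOfFlat
example : Registered.stub_fixedPartOnPuncturedCurve := stub_fixedPartOnPuncturedCurve
example : Registered.stub_anchoredExtension := stub_anchoredExtension

/-! ## §3 Glue (no `sorry` below this line) -/

section Glue

/-- **Classes already supported on a divisor extend with `B = 0`** along ANY hypersurface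
degeneration of `X` (the necessity audit of the route header, cheapest falsifier (b)/(c), in checked
form): `0` is rational, `0|_{W_t} = 0` is of type `(k,k)` on every smooth fibre (a Hodge model exists
by the proved route support `HodgeModels_holds`), and `α - 0 = α ∈ N¹`. -/
theorem limitExtension_of_mem_supportedClasses (hG : HypersurfaceDegeneration)
    ⦃k : ℕ⦄ ⦃X : SchemeOver ℂ⦄ (hk : 0 < k) (hX : IsSmoothProjective (2 * k) X)
    (α : complexBetti X (2 * k)) (hα : α ∈ supportedClasses X (2 * k) 1) :
    ∃ (T W : SchemeOver ℂ) (f : W ⟶ T) (t₀ : ComplexPoints T) (g : X ⟶ fiberOver f t₀)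
      (B : complexBetti W (2 * k)),
      SmoothOfRelativeDimension 1 T.hom ∧ IrreducibleSpace T.left ∧ Flat f.left ∧ IsProper f.left ∧
      (∃ U : X.left.Opens, (U : Set X.left).Nonempty ∧ IsOpenImmersion (U.ι ≫ g.left)) ∧
      IsRationalClass B ∧
      (∀ t : ComplexPoints T, t ≠ t₀ →
        (∃ d : ℕ, IsSmoothHypersurface (2 * k) d (fiberOver f t)) ∧
        IsOfHodgeType (2 * k) (fiberOver f t) (2 * k) k k (complexBetti.map (fiberι f t) (2 * k) B)) ∧
      α - complexBetti.map (g ≫ fiberι f t₀) (2 * k) B ∈ supportedClasses X (2 * k) 1 := by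
  obtain ⟨T, W, f, t₀, g, hT, hirr, hfl, hpr, hU, hhyp⟩ := hG hk hX
  refine ⟨T, W, f, t₀, g, 0, hT, hirr, hfl, hpr, hU, IsRationalClass.zero, fun t ht ↦ ?_, ?_⟩
  · obtain ⟨d, hd⟩ := hhyp t ht
    obtain ⟨A⟩ := Summit.HodgeConjecture.HodgeConjecture.Theses.LimitExtension.HodgeModels_holds hd.1
    refine ⟨⟨d, hd⟩, ?_⟩
    rw [map_zero]
    exact IsOfHodgeType.zero A _ _ _
  · simpa using hα

/-- **Anchored classes extend** : the anchored extension supplies the degeneration, the class `B` and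
one anchor fibre; the fixed part theorem on the punctured curve spreads the Hodge type `(k,k)` of
`B|_{W_{t₁}}` to every `W_t`, `t ≠ t₀`. -/
theorem limitExtension_of_not_mem_supportedClasses (hF : FixedPartOnPuncturedCurve)
    (hA : AnchoredExtension)
    ⦃k : ℕ⦄ ⦃X : SchemeOver ℂ⦄ (hk : 0 < k) (hX : IsSmoothProjective (2 * k) X)
    (α : complexBetti X (2 * k)) (hαQ : IsRationalClass α)
    (hαH : IsOfHodgeType (2 * k) X (2 * k) k k α) (hα : α ∉ supportedClasses X (2 * k) 1) :
    ∃ (T W : SchemeOver ℂ) (f : W ⟶ T) (t₀ : ComplexPoints T) (g : X ⟶ fiberOver f t₀)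
      (B : complexBetti W (2 * k)),
      SmoothOfRelativeDimension 1 T.hom ∧ IrreducibleSpace T.left ∧ Flat f.left ∧ IsProper f.left ∧
      (∃ U : X.left.Opens, (U : Set X.left).Nonempty ∧ IsOpenImmersion (U.ι ≫ g.left)) ∧
      IsRationalClass B ∧
      (∀ t : ComplexPoints T, t ≠ t₀ →
        (∃ d : ℕ, IsSmoothHypersurface (2 * k) d (fiberOver f t)) ∧
        IsOfHodgeType (2 * k) (fiberOver f t) (2 * k) k k (complexBetti.map (fiberι f t) (2 * k) B)) ∧
      α - complexBetti.map (g ≫ fiberι f t₀) (2 * k) B ∈ supportedClasses X (2 * k) 1 := by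
  obtain ⟨T, W, f, t₀, g, B, hT, hirr, hfl, hpr, hU, hB, hhyp, ⟨t₁, ht₁, hH₁⟩, hαB⟩ :=
    hA hk hX α hαQ hαH hα
  exact ⟨T, W, f, t₀, g, B, hT, hirr, hfl, hpr, hU, hB,
    fun t ht ↦ ⟨hhyp t ht, hF f t₀ B hT hirr hfl hpr hB hhyp t₁ ht₁ hH₁ t ht⟩, hαB⟩

end Glue

/-! ## §4 Composition: the crux BY NAME from the four registered stubs -/

/-- **`LimitExtension.LimitExtensionMid` from the stubs** (kernel-checked, no `sorry` of its own;
each hypothesis is a registered stub, keyed by name): split on whether `α` is already supported on a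
divisor — if so, `B = 0` on the hypersurface degeneration of `X` (stub G); if not, the anchored
extension (stub A) with the Hodge type spread over the punctured curve by the fixed part theorem
(stubs F1 ∘ F0). -/
theorem LimitExtensionMid_of (hG : Registered.stub_hypersurfaceDegeneration)
    (hF₀ : Registered.stub_hodgeClassOfFlat) (hF₁ : Registered.stub_fixedPartOnPuncturedCurve)
    (hA : Registered.stub_anchoredExtension) :
    Summit.HodgeConjecture.HodgeConjecture.Theses.LimitExtension.LimitExtensionMid := by
  intro k X hk hX α hαQ hαH
  by_cases hα : α ∈ supportedClasses X (2 * k) 1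
  · exact limitExtension_of_mem_supportedClasses hG hk hX α hα
  · exact limitExtension_of_not_mem_supportedClasses (hF₁ hF₀) hA hk hX α hαQ hαH hα

/-- Wiring check (an `example`, so that `LimitExtensionMid_of` stays the only theorem concluding the
crux): the registered stubs feed the composition as stated. -/
example : Summit.HodgeConjecture.HodgeConjecture.Theses.LimitExtension.LimitExtensionMid :=
  LimitExtensionMid_of stub_hypersurfaceDegeneration stub_hodgeClassOfFlat
    stub_fixedPartOnPuncturedCurve stub_anchoredExtension

end Summit.HodgeConjecture.HodgeConjecture.Cruxes.LimitExtensionMid.Birth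

end
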